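import Literature.Barriers.CriticalPhenomena.PlaquetteWalkHoleRootRingDichotomy
import HarnessLib

/-!
# Barrier catalogue (SAWScalingLimit): LAW L — THE SINGLE-REMOVAL CLASSIFICATION at Chebyshev distance `≥ 2`, one theorem

Assembly leaf (no new mechanism, no new definition) of `PlaquetteWalkHoleRootRingDichotomy` (the ring biconditional
`lawL_box_ring_kills_iff`) and `PlaquetteWalkHoleRootLawLDichotomy` (`lawL_box_not_killed_of_far`: cells at Chebyshev distance `≥ 3`
from the hole kill nothing, on the wall or not). Setting: the `m × n` box, hole `h` at distance `≥ 2` from every wall, root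
plaquette `(h.1 + 1, h.2)` rooted at `W`, far cell `(h.1 − 1, h.2)`; ONE further cell `(x, y)` at Chebyshev distance `≥ 2` from
the hole removed; the four universal kill statements `P₁ … P₄` of LAW L at the angle `θ` (every wound under-walk `w₂`-marked off
the far cell / over `w₁` / under `w₁` / over `w₂`).

★★★★★ `lawL_box_kills_iff`: at every `θ`, `P₁ ∨ P₂ ∨ P₃ ∨ P₄ ⟺ (x, y) = farWW ∨ ((x, y)` is a RING cell — Chebyshev distance
exactly `2` — AND a boundary cell of the box`)`. So among ALL single removals at distance `≥ 2` exactly these act on the route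
structure of the far-cell vertex functional: the far cell's outer neighbour (a closed door) and the near cells sitting ON a wall
(where the wall supplies the corridor / shut row / shut column / pocket / east-ray mechanism of `PlaquetteWalkHoleRootLawLWalls`);
`lawL_box_not_kills_of_far_or_offWall` is the contrapositive packaging. The hypothesis `hr` is discharged by
`rootedFace_hroot_boxMinus_of_two_le` (`PlaquetteWalkHoleRootInteriorRingBoxes`).

Not in print; venture lane «pcv-sawmu», seat b-step0 gen 27 (`HOME/FINDING-LAWL-STATEMENT-OF-RECORD.md` §A).

References: A. Glazman, I. Manolescu, arXiv:1708.00395v3, §1 (Fig. 2, the remark after eq. (1)), §2.1, §4.2 and Lemma 2.1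
[GlazmanManolescu2019]; A. Glazman, Electron. Commun. Probab. 20 (2015) no. 86, Lemma 3.1, proof pp. 6–7 [Glazman2015WeightedSAW];
R. Courant, H. Robbins, *What is Mathematics?* (1941/1958), Ch. V Appendix §2 (the even–odd rule) [CourantRobbins1958].
-/

noncomputable section

open Set Function Complex

namespace Literature.Barriers.CriticalPhenomena.PlaquetteWalk

open Literature.Probability.RandomPlanarGeometry.SAW.YangBaxter
open Real Complex

section Classification

variable {m n : ℕ} {h : Face}

/-- ★★★★★ **LAW L, THE SINGLE-REMOVAL CLASSIFICATION.** In the `m × n` box with the hole `h` at distance `≥ 2` from every wall,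
remove the hole and ONE cell `(x, y)` at Chebyshev distance `≥ 2` from it. Then, at every angle `θ`, SOME universal kill
statement of LAW L holds at the far cell of the root plaquette `(h.1 + 1, h.2)` IF AND ONLY IF the cell is the far cell's outer
neighbour `(h.1 − 2, h.2)`, or it is a ring cell (distance exactly `2`) lying on the boundary of the box. Ring cells:
`lawL_box_ring_kills_iff`; cells at distance `≥ 3` (boundary or not): `lawL_box_not_killed_of_far`.
[cite: GlazmanManolescu2019, §1 (Fig. 2 and the remark after eq. (1)), §2.1, §4.2, Lemma 2.1]
[cite: Glazman2015WeightedSAW, Lemma 3.1 (proof, pp. 6–7)] [cite: CourantRobbins1958, Ch. V Appendix §2 (the even–odd rule)] -/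
theorem lawL_box_kills_iff (hW : 2 ≤ h.1) (hE : h.1 + 3 ≤ m) (hS : 2 ≤ h.2) (hN : h.2 + 3 ≤ n) {x y : ℤ}
    (hfar : x + 2 ≤ h.1 ∨ h.1 + 2 ≤ x ∨ y + 2 ≤ h.2 ∨ h.2 + 2 ≤ y)
    (hr : RootedFace (dom (boxMinus m n [h, (x, y)])) (Face.side (h.1 + 1, h.2) .W) (farW (h.1 + 1, h.2))) (θ : ℝ) :
    ((∀ (ω : ΩG (dom (boxMinus m n [h, (x, y)])) (Face.side (h.1 + 1, h.2) .W) (farW (h.1 + 1, h.2))) (hb : ω.IsB2a),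
        ω.2.firstSideG = .S → ω.WE (fun _ => θ) ≠ excursionWinding θ ω.2.firstSideG (ω.z1 hr hb) ω.1 →
          ¬ω.2.W2FreeOff (farW (h.1 + 1, h.2))) ∨
      (∀ (ω : ΩG (dom (boxMinus m n [h, (x, y)])) (Face.side (h.1 + 1, h.2) .W) (farW (h.1 + 1, h.2))) (hb : ω.IsB2a),
        ω.2.firstSideG = .N → ω.WE (fun _ => θ) ≠ excursionWinding θ ω.2.firstSideG (ω.z1 hr hb) ω.1 →
          ¬ω.2.W1FreeOff (farW (h.1 + 1, h.2))) ∨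
      (∀ (ω : ΩG (dom (boxMinus m n [h, (x, y)])) (Face.side (h.1 + 1, h.2) .W) (farW (h.1 + 1, h.2))) (hb : ω.IsB2a),
        ω.2.firstSideG = .S → ω.WE (fun _ => θ) ≠ excursionWinding θ ω.2.firstSideG (ω.z1 hr hb) ω.1 →
          ¬ω.2.W1FreeOff (farW (h.1 + 1, h.2))) ∨
      (∀ (ω : ΩG (dom (boxMinus m n [h, (x, y)])) (Face.side (h.1 + 1, h.2) .W) (farW (h.1 + 1, h.2))) (hb : ω.IsB2a),
        ω.2.firstSideG = .N → ω.WE (fun _ => θ) ≠ excursionWinding θ ω.2.firstSideG (ω.z1 hr hb) ω.1 →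
          ¬ω.2.W2FreeOff (farW (h.1 + 1, h.2)))) ↔
      ((x = h.1 - 2 ∧ y = h.2) ∨
        ((h.1 - 2 ≤ x ∧ x ≤ h.1 + 2 ∧ h.2 - 2 ≤ y ∧ y ≤ h.2 + 2) ∧ (x = 0 ∨ x + 1 = m ∨ y = 0 ∨ y + 1 = n))) := by
  by_cases hnear : h.1 - 2 ≤ x ∧ x ≤ h.1 + 2 ∧ h.2 - 2 ≤ y ∧ y ≤ h.2 + 2
  · -- a ring cell: the dichotomy of `PlaquetteWalkHoleRootRingDichotomy`
    have hring : ((x = h.1 - 2 ∨ x = h.1 + 2) ∧ h.2 - 2 ≤ y ∧ y ≤ h.2 + 2) ∨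
        ((y = h.2 - 2 ∨ y = h.2 + 2) ∧ h.1 - 2 ≤ x ∧ x ≤ h.1 + 2) := by omega
    rw [lawL_box_ring_kills_iff hW hE hS hN hring hr θ]
    constructor
    · rintro (hw | hw)
      · exact Or.inl hw
      · exact Or.inr ⟨hnear, hw⟩
    · rintro (hw | ⟨-, hw⟩)
      · exact Or.inl hw
      · exact Or.inr hw
  · -- a cell at distance `≥ 3`: nothing is killed, and the right-hand side is false
    obtain ⟨n1, n2, n3, n4⟩ := lawL_box_not_killed_of_far (S := [h, (x, y)]) hW hE hS hN (fun s hs => by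
      simp only [List.mem_cons, List.not_mem_nil, or_false] at hs
      rcases hs with rfl | rfl
      · exact Or.inl rfl
      · right; simp only [FarFromHole]; omega) hr θ
    constructor
    · rintro (hk | hk | hk | hk)
      · exact absurd hk n1
      · exact absurd hk n2
      · exact absurd hk n3
      · exact absurd hk n4
    · rintro (⟨hx, hy⟩ | ⟨hn', -⟩)
      · exact absurd ⟨by omega, by omega, by omega, by omega⟩ hnear
      · exact absurd hn' hnear

/-- ★★★★ The contrapositive packaging: a cell at Chebyshev distance `≥ 2`, other than `farWW`, that is either at distance `≥ 3`
or off the boundary of the box kills NOTHING (all four kill statements fail, every `θ`).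
[cite: GlazmanManolescu2019, §1 (Fig. 2 and the remark after eq. (1)), §2.1, Lemma 2.1] [cite: Glazman2015WeightedSAW, Lemma 3.1 (proof, pp. 6–7)] -/
theorem lawL_box_not_kills_of_far_or_offWall (hW : 2 ≤ h.1) (hE : h.1 + 3 ≤ m) (hS : 2 ≤ h.2) (hN : h.2 + 3 ≤ n) {x y : ℤ}
    (hfar : x + 2 ≤ h.1 ∨ h.1 + 2 ≤ x ∨ y + 2 ≤ h.2 ∨ h.2 + 2 ≤ y) (hWW : ¬(x = h.1 - 2 ∧ y = h.2))
    (hoff : ¬(h.1 - 2 ≤ x ∧ x ≤ h.1 + 2 ∧ h.2 - 2 ≤ y ∧ y ≤ h.2 + 2) ∨ ¬(x = 0 ∨ x + 1 = m ∨ y = 0 ∨ y + 1 = n))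
    (hr : RootedFace (dom (boxMinus m n [h, (x, y)])) (Face.side (h.1 + 1, h.2) .W) (farW (h.1 + 1, h.2))) (θ : ℝ) :
    (¬ ∀ (ω : ΩG (dom (boxMinus m n [h, (x, y)])) (Face.side (h.1 + 1, h.2) .W) (farW (h.1 + 1, h.2))) (hb : ω.IsB2a),
        ω.2.firstSideG = .S → ω.WE (fun _ => θ) ≠ excursionWinding θ ω.2.firstSideG (ω.z1 hr hb) ω.1 →
          ¬ω.2.W2FreeOff (farW (h.1 + 1, h.2))) ∧
      (¬ ∀ (ω : ΩG (dom (boxMinus m n [h, (x, y)])) (Face.side (h.1 + 1, h.2) .W) (farW (h.1 + 1, h.2))) (hb : ω.IsB2a),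
        ω.2.firstSideG = .N → ω.WE (fun _ => θ) ≠ excursionWinding θ ω.2.firstSideG (ω.z1 hr hb) ω.1 →
          ¬ω.2.W1FreeOff (farW (h.1 + 1, h.2))) ∧
      (¬ ∀ (ω : ΩG (dom (boxMinus m n [h, (x, y)])) (Face.side (h.1 + 1, h.2) .W) (farW (h.1 + 1, h.2))) (hb : ω.IsB2a),
        ω.2.firstSideG = .S → ω.WE (fun _ => θ) ≠ excursionWinding θ ω.2.firstSideG (ω.z1 hr hb) ω.1 →
          ¬ω.2.W1FreeOff (farW (h.1 + 1, h.2))) ∧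
      (¬ ∀ (ω : ΩG (dom (boxMinus m n [h, (x, y)])) (Face.side (h.1 + 1, h.2) .W) (farW (h.1 + 1, h.2))) (hb : ω.IsB2a),
        ω.2.firstSideG = .N → ω.WE (fun _ => θ) ≠ excursionWinding θ ω.2.firstSideG (ω.z1 hr hb) ω.1 →
          ¬ω.2.W2FreeOff (farW (h.1 + 1, h.2))) := by
  have hiff := lawL_box_kills_iff hW hE hS hN hfar hr θ
  have hno : ¬((x = h.1 - 2 ∧ y = h.2) ∨
      ((h.1 - 2 ≤ x ∧ x ≤ h.1 + 2 ∧ h.2 - 2 ≤ y ∧ y ≤ h.2 + 2) ∧ (x = 0 ∨ x + 1 = m ∨ y = 0 ∨ y + 1 = n))) := by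
    rintro (hw | ⟨hn', hb'⟩)
    · exact hWW hw
    · rcases hoff with ho | ho
      · exact ho hn'
      · exact ho hb'
  have hk := fun hh' => hno (hiff.1 hh')
  refine ⟨fun h1 => hk (Or.inl h1), fun h2 => hk (Or.inr (Or.inl h2)), fun h3 => hk (Or.inr (Or.inr (Or.inl h3))),
    fun h4 => hk (Or.inr (Or.inr (Or.inr h4)))⟩

/-- ★★★★★ **LAW L, THE SINGLE-REMOVAL CLASSIFICATION — closed form** (the rooting hypothesis discharged by
`rootedFace_hroot_boxMinus_of_two_le`): hole `≥ 2` from every wall, one cell `(x, y)` at Chebyshev distance `≥ 2` removed;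
at every `θ`, some kill statement of LAW L holds `⟺ (x, y) = (h.1 − 2, h.2)` or `(x, y)` is a ring cell on the boundary.
[cite: GlazmanManolescu2019, §1 (Fig. 2 and the remark after eq. (1)), §2.1, §4.2, Lemma 2.1]
[cite: Glazman2015WeightedSAW, Lemma 3.1 (proof, pp. 6–7)] [cite: CourantRobbins1958, Ch. V Appendix §2 (the even–odd rule)] -/
theorem lawL_box_kills_iff_of_two_le (hW : 2 ≤ h.1) (hE : h.1 + 3 ≤ m) (hS : 2 ≤ h.2) (hN : h.2 + 3 ≤ n) {x y : ℤ}
    (hfar : x + 2 ≤ h.1 ∨ h.1 + 2 ≤ x ∨ y + 2 ≤ h.2 ∨ h.2 + 2 ≤ y) (θ : ℝ) :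
    ((∀ (ω : ΩG (dom (boxMinus m n [h, (x, y)])) (Face.side (h.1 + 1, h.2) .W) (farW (h.1 + 1, h.2))) (hb : ω.IsB2a),
        ω.2.firstSideG = .S → ω.WE (fun _ => θ) ≠
          excursionWinding θ ω.2.firstSideG (ω.z1 (rootedFace_hroot_boxMinus_of_two_le hW hE hS hN hfar) hb) ω.1 →
          ¬ω.2.W2FreeOff (farW (h.1 + 1, h.2))) ∨
      (∀ (ω : ΩG (dom (boxMinus m n [h, (x, y)])) (Face.side (h.1 + 1, h.2) .W) (farW (h.1 + 1, h.2))) (hb : ω.IsB2a),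
        ω.2.firstSideG = .N → ω.WE (fun _ => θ) ≠
          excursionWinding θ ω.2.firstSideG (ω.z1 (rootedFace_hroot_boxMinus_of_two_le hW hE hS hN hfar) hb) ω.1 →
          ¬ω.2.W1FreeOff (farW (h.1 + 1, h.2))) ∨
      (∀ (ω : ΩG (dom (boxMinus m n [h, (x, y)])) (Face.side (h.1 + 1, h.2) .W) (farW (h.1 + 1, h.2))) (hb : ω.IsB2a),
        ω.2.firstSideG = .S → ω.WE (fun _ => θ) ≠
          excursionWinding θ ω.2.firstSideG (ω.z1 (rootedFace_hroot_boxMinus_of_two_le hW hE hS hN hfar) hb) ω.1 →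
          ¬ω.2.W1FreeOff (farW (h.1 + 1, h.2))) ∨
      (∀ (ω : ΩG (dom (boxMinus m n [h, (x, y)])) (Face.side (h.1 + 1, h.2) .W) (farW (h.1 + 1, h.2))) (hb : ω.IsB2a),
        ω.2.firstSideG = .N → ω.WE (fun _ => θ) ≠
          excursionWinding θ ω.2.firstSideG (ω.z1 (rootedFace_hroot_boxMinus_of_two_le hW hE hS hN hfar) hb) ω.1 →
          ¬ω.2.W2FreeOff (farW (h.1 + 1, h.2)))) ↔
      ((x = h.1 - 2 ∧ y = h.2) ∨
        ((h.1 - 2 ≤ x ∧ x ≤ h.1 + 2 ∧ h.2 - 2 ≤ y ∧ y ≤ h.2 + 2) ∧ (x = 0 ∨ x + 1 = m ∨ y = 0 ∨ y + 1 = n))) :=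
  lawL_box_kills_iff hW hE hS hN hfar (rootedFace_hroot_boxMinus_of_two_le hW hE hS hN hfar) θ

end Classification

end Literature.Barriers.CriticalPhenomena.PlaquetteWalk
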